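import Summits.ResolutionOfSingularities.ResolutionOfSingularities.Theorems.PurelyInseparableDim4JointZigzagStep
import Summits.ResolutionOfSingularities.ResolutionOfSingularities.Theorems.PurelyInseparableDim4JointSurvival
import Summits.ResolutionOfSingularities.ResolutionOfSingularities.Theorems.PurelyInseparableDim4PointTreeWalk
import HarnessLib

/-!
# Purely inseparable four-folds: the JOINT TREE — finitely many pairwise disjoint COORDINATE members and POINT members,
# blown up in turn through any blowings up, as ONE marked resolution (brick S3 (c) «joint point∘coordinate chains»,
# part 7, cell `res-dim4-pi`; consumes typ-2 g3's (3a)/(3b) and typ-3's (3c))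

[OURS · counted 0] (D-0157 DOOR 2; desk WORD #66 (4)(c), #74 (g); frame `PIDim4.TerminationImpliesOrderReduction`,
S3 (c); host item stmt-ResolutionOfSingularities-16155, helper). Nothing here proves resolution of singularities in
dimension ≥ 4 / characteristic `p` — NOT here, not anywhere in this programme.

A JOINT CONFIGURATION on an admissible prefix `M₀ ⇝ M′` (`IsMultipleBlowup M₀ σ M′`, `M₀` on a locally Noetherian
Jacobson `X`, `HasSNC M₀.boundary`, `mult = p`, `K = K̄`) consists of
* POINT members: finitely many closed points `x` with typ-3's `…PointTreeLocal` data (clean `p`-fold state,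
  `Acc` of the point walk, hereditary one-step finiteness, zigzag chart reading `(z^p + s.F)·𝒪`);
* COORDINATE members: finitely many closed sets `c` with a state `s` (`s.F ≠ 0` clean), a Hironaka-permissible centre
  set `S`, `IsRegular (vanishingIdeal c).subscheme`, `HasSNCWith M′.boundary (vanishingIdeal c)` (FC-1, GLOBAL form),
  finitely many equimultiple pairs over `S` with well-founded finitely-branching POINT walks below every successor, and
  a ZIGZAG chart `X′ ←φ— Y —ψ→ 𝔸⁵` reading `M′` as `(z^p + s.F)·𝒪`, reading `vanishingIdeal c` as `𝓘Λ S`, covering `c`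
  and seeing the whole centre `V(z, x_S)` (the configuration invariant of record, bus 22:13:48Z);
* pairwise disjoint, and covering every closed point of order `≥ p` of `M′`.

* **`exists_isMarkedResolution_of_joint_config`** — every joint configuration leads to a marked resolution of `M₀`
  (BGMW Def. 3.1.3). Induction on the number of coordinate members: with none left this is typ-3 g2's point forest
  (`exists_isMarkedResolution_of_config_local`); otherwise blow up one coordinate member along `vanishingIdeal c₁`
  (admissible: `IsMultipleBlowup.blowup` with the member's regularity / snc data and `c₁ ⊆ supp M′` read on the chart),
  the new stage carrying the joint configuration (point survivors: typ-3 g2 zigzag survival; coordinate survivors: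
  part 4 `member_survival_global/zigzag`; new POINT members over `c₁`: part 6 `coord_zigzag_step_package`, finitely many
  by `finite_closedOver_zigzag_coord_of_finite_pairs`).

HONEST SCOPE: coordinate members are blown up in ANY order interleaved with nothing else needed — all their blow-ups are
admissible through any earlier blow-ups — but their SUCCESSORS are points (finite branching over each coordinate
centre); positive-dimensional successors (typ-2 g3's 3b⁺ boundary devices) are the next brick. Nothing about
termination. AI-produced formalisation, weaker than expert review.
bears_on: LADDER-RESOLUTION:D157-DOOR2 (res-dim4-pi · S3 (c) joint tree).
-/

set_option linter.dupNamespace false -- D-0017: single-problem summit path `Summit.<S>.<S>.…` by design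

noncomputable section

open MvPolynomial Finset CategoryTheory AlgebraicGeometry Opposite TopologicalSpace
open AlgebraicGeometry.Scheme.IdealSheafData (ofIdealTop vanishingIdeal)

namespace Summit.ResolutionOfSingularities.ResolutionOfSingularities.Theorems.PIDim4

open Literature.AlgebraicGeometry.Resolution
open Literature.AlgebraicGeometry.Resolution.Hauser2010
open Literature.AlgebraicGeometry.Resolution.AffinePointBlowup (P A γ coord Wtop ξ)

namespace Equimultiple

/-! ## §1 A coordinate member read on its zigzag chart -/

section Member

variable {K : Type} [Field K] {p : ℕ} [hp : Fact p.Prime] [CharP K p]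
variable {X' Y : Scheme.{0}} (φ : Y ⟶ X') [IsOpenImmersion φ] (ψ : Y ⟶ P 4 K) [IsOpenImmersion ψ]
  {S : Finset (Fin 4)}

omit hp [CharP K p] [IsOpenImmersion φ] [IsOpenImmersion ψ] in
/-- On the zigzag chart of a member, `φ y ∈ c ↔ ψ y ∈ V(z, x_S)`. [folklore] -/
theorem mem_member_iff_mem_CΛ (c : Closeds X')
    (hZ : (vanishingIdeal c).comap φ = (AffineCoordBlowup.𝓘Λ 4 K (insert 0 (Fin.succ '' (S : Set (Fin 4))))).comap ψ)
    (y : Y) : φ y ∈ (c : Set X') ↔ ψ y ∈ AffineCoordBlowup.CΛ 4 K (insert 0 (Fin.succ '' (S : Set (Fin 4)))) := by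
  have h1 : y ∈ (((vanishingIdeal c).comap φ).support : Set Y) ↔ φ y ∈ (c : Set X') := by
    rw [Scheme.IdealSheafData.support_comap]
    change φ y ∈ ((vanishingIdeal c).support : Set X') ↔ _
    rw [Scheme.IdealSheafData.coe_support_vanishingIdeal]
  have h2 : y ∈ (((AffineCoordBlowup.𝓘Λ 4 K (insert 0 (Fin.succ '' (S : Set (Fin 4))))).comap ψ).support : Set Y) ↔
      ψ y ∈ AffineCoordBlowup.CΛ 4 K (insert 0 (Fin.succ '' (S : Set (Fin 4)))) := by
    rw [Scheme.IdealSheafData.support_comap, AffineCoordBlowup.support_𝓘Λ]; rfl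
  rw [← h1, hZ, h2]

omit hp [CharP K p] [IsOpenImmersion φ] [IsOpenImmersion ψ] in
/-- **The member IS the chart image of the centre**: `c = φ(ψ⁻¹ V(z, x_S))`. [folklore] -/
theorem coe_member_eq_image (c : Closeds X')
    (hZ : (vanishingIdeal c).comap φ = (AffineCoordBlowup.𝓘Λ 4 K (insert 0 (Fin.succ '' (S : Set (Fin 4))))).comap ψ)
    (hcφ : (c : Set X') ⊆ Set.range φ) :
    φ '' (ψ ⁻¹' (AffineCoordBlowup.CΛ 4 K (insert 0 (Fin.succ '' (S : Set (Fin 4)))) : Set (P 4 K))) = (c : Set X') := by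
  ext x
  constructor
  · rintro ⟨y, hy, rfl⟩
    exact (mem_member_iff_mem_CΛ φ ψ c hZ y).mpr hy
  · intro hx
    obtain ⟨y, rfl⟩ := hcφ hx
    exact ⟨y, (mem_member_iff_mem_CΛ φ ψ c hZ y).mp hx, rfl⟩

omit hp [CharP K p] in
/-- **A coordinate member lies in the support** (BGMW Def. 3.1.3 (1)), read on its zigzag chart. -/
theorem coe_member_subset_support [IsLocallyNoetherian X'] (M' : MarkedIdeal X') (hmult : M'.mult = p)
    (F : MvPolynomial (Fin 4) K) (hM : M'.ideal.comap φ = (hypSheaf p F).comap ψ)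
    (hperm : (p : ℕ∞) ≤ CentreBlowup.ordAlong S F) (c : Closeds X')
    (hZ : (vanishingIdeal c).comap φ = (AffineCoordBlowup.𝓘Λ 4 K (insert 0 (Fin.succ '' (S : Set (Fin 4))))).comap ψ)
    (hcφ : (c : Set X') ⊆ Set.range φ) : (c : Set X') ⊆ M'.support := by
  intro x hx
  obtain ⟨y, rfl⟩ := hcφ hx
  change (M'.mult : ℕ∞) ≤ idealOrder M'.ideal (φ y)
  rw [hmult, ← idealOrder_comap_of_isOpenImmersion φ M'.ideal y, hM, idealOrder_comap_of_isOpenImmersion ψ _ y]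
  exact ChartDictionary.le_idealOrder_hypSheaf_of_mem_CΛ p S F hperm ((mem_member_iff_mem_CΛ φ ψ c hZ y).mp hx)

end Member

/-! ## §2 The joint tree -/

section JointTree

variable {K : Type} [Field K] {p : ℕ} [hp : Fact p.Prime] [CharP K p]

/-- **THE JOINT TREE.** See the module docstring for the data; conclusion: `∃ X″ ρ M″, IsMarkedResolution M₀ ρ M″`.
[cite: BierstoneGrigorievMilmanWlodarczyk2011, Def. 3.1.3; §4 Step 2b] [cite: Hauser2010, §§F–G]
[cite: Hironaka1964, Main Theorem I (the characteristic-zero statement whose analogue is asked)] -/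
theorem exists_isMarkedResolution_of_joint_config {X : Scheme.{0}} [IsLocallyNoetherian X] [JacobsonSpace X]
    [IsAlgClosed K] [DecidableEq K] (M₀ : MarkedIdeal X) (hE : HasSNC M₀.boundary) (hmult : M₀.mult = p) (n : ℕ) :
    ∀ (X' : Scheme.{0}) (σ : X' ⟶ X) (M' : MarkedIdeal X') (_ : IsMultipleBlowup M₀ σ M')
      (pts : Finset X') (st : X' → State K) (_ : ∀ x ∈ pts, IsClosed ({x} : Set X'))
      (_ : ∀ x ∈ pts, (st x).F ≠ 0 ∧
        Literature.Barriers.ResolutionOfSingularities.HauserPerlega.IsClean p (st x).F ∧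
        (p : ℕ∞) ≤ CentreBlowup.ordAlong (Finset.univ : Finset (Fin 4)) (st x).F ∧
        Acc (fun s' s : State K => Edge p Finset.univ s s') (st x) ∧
        (∀ s' : State K, Relation.ReflTransGen (fun a b : State K => Edge p Finset.univ a b) (st x) s' →
          {w' : blowup (Scheme.IdealSheafData.vanishingIdeal (AffinePointBlowup.C₀ 4 K)) |
            IsClosed ({w'} : Set (blowup (Scheme.IdealSheafData.vanishingIdeal (AffinePointBlowup.C₀ 4 K)))) ∧
            blowup.π (Scheme.IdealSheafData.vanishingIdeal (AffinePointBlowup.C₀ 4 K)) w' = ξ 4 K ∧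
            (p : ℕ∞) ≤ idealOrder ((⟨hypSheaf p s'.F, [], p⟩ : MarkedIdeal (P 4 K)).transform
              (blowup.π (Scheme.IdealSheafData.vanishingIdeal (AffinePointBlowup.C₀ 4 K)))
              (Scheme.IdealSheafData.vanishingIdeal (AffinePointBlowup.C₀ 4 K))).ideal w'}.Finite) ∧
        ∃ (Y : Scheme.{0}) (φ : Y ⟶ X') (ψ : Y ⟶ P 4 K) (_ : IsOpenImmersion φ) (_ : IsOpenImmersion ψ) (y : Y),
          φ y = x ∧ ψ y = ξ 4 K ∧ M'.ideal.comap φ = (hypSheaf p (st x).F).comap ψ)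
      (cms : Finset (Closeds X')) (_ : cms.card = n) (cst : Closeds X' → State K)
      (ctr : Closeds X' → Finset (Fin 4))
      (_ : ∀ c ∈ cms, (cst c).F ≠ 0 ∧
        Literature.Barriers.ResolutionOfSingularities.HauserPerlega.IsClean p (cst c).F ∧
        IsPermissibleCentre p (ctr c) (cst c).F ∧
        Scheme.IsRegular (vanishingIdeal c).subscheme ∧ HasSNCWith M'.boundary (vanishingIdeal c) ∧
        {jb : Fin 4 × (Fin 4 → K) | jb.1 ∈ ctr c ∧ jb.2 jb.1 = 0 ∧
          CentreBlowup.IsEquimultiplePoint p (ctr c) jb.1 jb.2 (cst c)}.Finite ∧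
        (∀ (j : Fin 4) (b : Fin 4 → K), j ∈ ctr c → b j = 0 →
          CentreBlowup.IsEquimultiplePoint p (ctr c) j b (cst c) →
          Acc (fun s' s : State K => Edge p Finset.univ s s') (CentreBlowup.step p (ctr c) j b (cst c)) ∧
            ∀ s' : State K, Relation.ReflTransGen (fun a e : State K => Edge p Finset.univ a e)
                (CentreBlowup.step p (ctr c) j b (cst c)) s' →
              {jb : Fin 4 × (Fin 4 → K) | jb.2 jb.1 = 0 ∧
                CentreBlowup.IsEquimultiplePoint p Finset.univ jb.1 jb.2 s'}.Finite) ∧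
        ∃ (Y : Scheme.{0}) (φ : Y ⟶ X') (ψ : Y ⟶ P 4 K) (_ : IsOpenImmersion φ) (_ : IsOpenImmersion ψ),
          M'.ideal.comap φ = (hypSheaf p (cst c).F).comap ψ ∧
          (vanishingIdeal c).comap φ =
            (AffineCoordBlowup.𝓘Λ 4 K (insert 0 (Fin.succ '' ((ctr c : Finset (Fin 4)) : Set (Fin 4))))).comap ψ ∧
          (c : Set X') ⊆ Set.range φ ∧
          (AffineCoordBlowup.CΛ 4 K (insert 0 (Fin.succ '' ((ctr c : Finset (Fin 4)) : Set (Fin 4)))) : Set (P 4 K)) ⊆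
            Set.range ψ)
      (_ : ∀ c ∈ cms, ∀ c' ∈ cms, c ≠ c' → Disjoint (c : Set X') (c' : Set X'))
      (_ : ∀ x ∈ pts, ∀ c ∈ cms, x ∉ (c : Set X'))
      (_ : ∀ z : X', IsClosed ({z} : Set X') → (p : ℕ∞) ≤ idealOrder M'.ideal z →
        z ∈ pts ∨ ∃ c ∈ cms, z ∈ (c : Set X')),
      ∃ (X'' : Scheme.{0}) (ρ : X'' ⟶ X) (M'' : MarkedIdeal X''), IsMarkedResolution M₀ ρ M'' := by
  classical
  induction n with
  | zero =>
    intro X' σ M' hσ pts st hclosed hdata cms hcard cst ctr _ _ _ hcover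
    have hcms : cms = ∅ := Finset.card_eq_zero.mp hcard
    haveI : Std.Irrefl (fun s' s : State K => Edge p Finset.univ s s' ∧ s' ≠ s) := ⟨fun s hs => hs.2 rfl⟩
    have hT : Acc (Relation.CutExpand (fun s' s : State K => Edge p Finset.univ s s' ∧ s' ≠ s))
        (pts.val.map st) := by
      refine Relation.acc_of_singleton fun s hs => ?_
      rw [Multiset.mem_map] at hs
      obtain ⟨x, hx, rfl⟩ := hs
      exact (Subrelation.accessible (fun hs => hs.1) (hdata x (Finset.mem_val.mp hx)).2.2.2.1).cutExpand
    refine exists_isMarkedResolution_of_config_local M₀ hE hmult _ hT X' σ M' hσ pts st rfl hclosed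
      (fun z hz hzo => ?_) hdata
    rcases hcover z hz hzo with h | ⟨c, hc, -⟩
    · exact h
    · rw [hcms] at hc
      exact absurd hc (Finset.notMem_empty c)
  | succ n ih =>
    intro X' σ M' hσ pts st hclosed hdata cms hcard cst ctr hcdata hdisj₁ hdisj₂ hcover
    haveI : IsLocallyNoetherian X' := hσ.isLocallyNoetherian
    haveI : JacobsonSpace X' := jacobsonSpace_of_isMultipleBlowup hσ
    have hmult' : M'.mult = p := hσ.mult_eq.trans hmult
    -- blow up one coordinate member
    obtain ⟨c₁, hc₁⟩ : cms.Nonempty := Finset.card_pos.mp (by rw [hcard]; exact Nat.succ_pos n)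
    obtain ⟨hF₁, hclean₁, hS₁, hreg₁, hsnc₁, hfin₁, hwalk₁, Y, φ, ψ, _, _, hM₁, hZ₁, hcφ₁, hsee₁⟩ := hcdata c₁ hc₁
    set C : X'.IdealSheafData := vanishingIdeal c₁ with hC
    have hπ : IsBlowup (blowup.π C) C := blowup.isBlowup C
    have hCsupp : ∀ z : X', z ∉ (C.support : Set X') ↔ z ∉ (c₁ : Set X') := fun z => by
      rw [hC, Scheme.IdealSheafData.coe_support_vanishingIdeal]
    have himg := coe_member_eq_image φ ψ c₁ hZ₁ hcφ₁
    have h₁ : IsMultipleBlowup M₀ (blowup.π C ≫ σ) (M'.transform (blowup.π C) C) :=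
      IsMultipleBlowup.blowup hσ C (blowup.π C) hπ hreg₁
        (by rw [hC, Scheme.IdealSheafData.coe_support_vanishingIdeal]
            exact coe_member_subset_support φ ψ M' hmult' _ hM₁ hS₁.2 c₁ hZ₁ hcφ₁) hsnc₁
    haveI : IsLocallyNoetherian (blowup C) := h₁.isLocallyNoetherian
    set M'' := M'.transform (blowup.π C) C with hM''
    have hM''I : M''.ideal = controlledTransform (blowup.π C) C M'.ideal M'.mult := rfl
    -- the package at the closed order-`p` points over `c₁`, pair in front
    have pkg : ∀ w : blowup C, IsClosed ({w} : Set (blowup C)) → blowup.π C w ∈ (c₁ : Set X') →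
        (p : ℕ∞) ≤ idealOrder M''.ideal w →
        ∃ jb : Fin 4 × (Fin 4 → K), jb.1 ∈ ctr c₁ ∧ jb.2 jb.1 = 0 ∧
          Edge p (ctr c₁) (cst c₁) (CentreBlowup.step p (ctr c₁) jb.1 jb.2 (cst c₁)) ∧
          CentreBlowup.IsEquimultiplePoint p (ctr c₁) jb.1 jb.2 (cst c₁) ∧
          ∃ (Y' : Scheme.{0}) (φ' : Y' ⟶ blowup C) (ψ' : Y' ⟶ P 4 K) (_ : IsOpenImmersion φ') (_ : IsOpenImmersion ψ')
            (y' : Y'), φ' y' = w ∧ ψ' y' = ξ 4 K ∧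
            M''.ideal.comap φ' = (hypSheaf p (CentreBlowup.step p (ctr c₁) jb.1 jb.2 (cst c₁)).F).comap ψ' := by
      intro w hw hwx hord
      rw [← himg] at hwx
      obtain ⟨j, b, hj, hbj, hedge, heq, Y', φ', ψ', _, _, y', hφ', hψ', hc'⟩ :=
        coord_zigzag_step_package φ ψ C hZ₁ hπ M' hmult' (cst c₁) hM₁ hF₁ hclean₁ hS₁ hw hwx hord
      exact ⟨(j, b), hj, hbj, hedge, heq, Y', φ', ψ', inferInstance, inferInstance, y', hφ', hψ', hc'⟩
    -- new point members over `c₁`: finitely many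
    have hoverfin : {w : blowup C | IsClosed ({w} : Set (blowup C)) ∧ blowup.π C w ∈ (c₁ : Set X') ∧
        (p : ℕ∞) ≤ idealOrder M''.ideal w}.Finite := by
      have h := finite_closedOver_zigzag_coord_of_finite_pairs φ ψ C hZ₁ hπ M' hmult' (cst c₁) hM₁ hS₁.2 hfin₁
      rw [himg] at h
      exact h
    set ov : Finset (blowup C) := hoverfin.toFinset with hov_def
    have hmem_over : ∀ w, w ∈ ov ↔ IsClosed ({w} : Set (blowup C)) ∧ blowup.π C w ∈ (c₁ : Set X') ∧
        (p : ℕ∞) ≤ idealOrder M''.ideal w := fun w => by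
      rw [hov_def, Set.Finite.mem_toFinset, Set.mem_setOf_eq]
    -- point survivors
    have hpre : ∀ z : {z // z ∈ pts}, ∃ w : blowup C, blowup.π C w = z.1 := fun z =>
      exists_eq_of_not_mem_support hπ ((hCsupp z.1).mpr (hdisj₂ z.1 z.2 c₁ hc₁))
    set pre : {z // z ∈ pts} → blowup C := fun z => (hpre z).choose with hpre_def
    have hπpre : ∀ z : {z // z ∈ pts}, blowup.π C (pre z) = z.1 := fun z => (hpre z).choose_spec
    have hpre_inj : Function.Injective pre := by
      intro z z' hzz
      apply Subtype.ext
      rw [← hπpre z, ← hπpre z', hzz]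
    set surv : Finset (blowup C) := pts.attach.image pre with hsurv_def
    have hmem_surv : ∀ w, w ∈ surv ↔ blowup.π C w ∈ pts := by
      intro w
      rw [hsurv_def, Finset.mem_image]
      constructor
      · rintro ⟨z, -, rfl⟩
        rw [hπpre z]
        exact z.2
      · intro hw
        refine ⟨⟨blowup.π C w, hw⟩, Finset.mem_attach _ _, ?_⟩
        exact eq_of_eq_of_not_mem_support hπ (hπpre _) (by rw [hπpre]; exact (hCsupp _).mpr (hdisj₂ _ hw c₁ hc₁))
    have hdisj : Disjoint ov surv := by
      rw [Finset.disjoint_left]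
      intro w hw hw'
      exact hdisj₂ _ ((hmem_surv w).mp hw') c₁ hc₁ ((hmem_over w).mp hw).2.1
    set pts' : Finset (blowup C) := ov.disjUnion surv hdisj with hpts'
    have hmem' : ∀ w, w ∈ pts' ↔ w ∈ ov ∨ w ∈ surv := fun w => Finset.mem_disjUnion
    have hsurv_ord : ∀ w : blowup C, blowup.π C w ∉ (c₁ : Set X') →
        idealOrder M''.ideal w = idealOrder M'.ideal (blowup.π C w) := fun w hwx => by
      rw [hM''I]
      exact idealOrder_controlledTransform_eq_of_eq_of_not_mem_support hπ ((hCsupp _).mpr hwx) M'.ideal M'.mult rfl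
    -- the new point states
    set st' : blowup C → State K := fun w =>
      if hc : IsClosed ({w} : Set (blowup C)) ∧ blowup.π C w ∈ (c₁ : Set X') ∧ (p : ℕ∞) ≤ idealOrder M''.ideal w then
        CentreBlowup.step p (ctr c₁) (pkg w hc.1 hc.2.1 hc.2.2).choose.1 (pkg w hc.1 hc.2.1 hc.2.2).choose.2 (cst c₁)
      else st (blowup.π C w) with hst'
    have hover : ∀ w ∈ ov, ∃ (j : Fin 4) (b : Fin 4 → K), st' w = CentreBlowup.step p (ctr c₁) j b (cst c₁) ∧
        j ∈ ctr c₁ ∧ b j = 0 ∧ Edge p (ctr c₁) (cst c₁) (CentreBlowup.step p (ctr c₁) j b (cst c₁)) ∧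
        CentreBlowup.IsEquimultiplePoint p (ctr c₁) j b (cst c₁) ∧
        ∃ (Y' : Scheme.{0}) (φ' : Y' ⟶ blowup C) (ψ' : Y' ⟶ P 4 K) (_ : IsOpenImmersion φ') (_ : IsOpenImmersion ψ')
          (y' : Y'), φ' y' = w ∧ ψ' y' = ξ 4 K ∧
          M''.ideal.comap φ' = (hypSheaf p (CentreBlowup.step p (ctr c₁) j b (cst c₁)).F).comap ψ' := by
      intro w hw
      have hc := (hmem_over w).mp hw
      refine ⟨(pkg w hc.1 hc.2.1 hc.2.2).choose.1, (pkg w hc.1 hc.2.1 hc.2.2).choose.2, ?_,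
        (pkg w hc.1 hc.2.1 hc.2.2).choose_spec⟩
      rw [hst']
      exact dif_pos hc
    have hoff : ∀ w : blowup C, blowup.π C w ∉ (c₁ : Set X') → st' w = st (blowup.π C w) := by
      intro w hwx
      rw [hst']
      exact dif_neg fun hc => hwx hc.2.1
    -- coordinate survivors
    set cms' : Finset (Closeds (blowup C)) :=
      (cms.erase c₁).image fun c => c.preimage (blowup.π C).continuous with hcms'
    have hdisjC : ∀ c ∈ cms.erase c₁, Disjoint (c : Set X') (C.support : Set X') := by
      intro c hc
      rw [hC, Scheme.IdealSheafData.coe_support_vanishingIdeal]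
      exact hdisj₁ c (Finset.mem_of_mem_erase hc) c₁ hc₁ (Finset.ne_of_mem_erase hc)
    have hinj : Set.InjOn (fun c : Closeds X' => c.preimage (blowup.π C).continuous) ↑(cms.erase c₁) := by
      intro c hc c' hc' hcc
      have key : ∀ {d d' : Closeds X'}, d ∈ cms.erase c₁ → d.preimage (blowup.π C).continuous =
          d'.preimage (blowup.π C).continuous → (d : Set X') ⊆ (d' : Set X') := by
        intro d d' hd hdd x hx
        obtain ⟨w, hw⟩ := exists_eq_of_not_mem_support hπ (Set.disjoint_left.mp (hdisjC d hd) hx)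
        have hw' : w ∈ (d.preimage (blowup.π C).continuous : Set (blowup C)) := by
          change blowup.π C w ∈ (d : Set X'); rw [hw]; exact hx
        rw [hdd] at hw'
        change blowup.π C w ∈ (d' : Set X') at hw'
        rw [hw] at hw'
        exact hw'
      exact Closeds.ext (Set.Subset.antisymm (key hc hcc) (key hc' hcc.symm))
    have hcard' : cms'.card = n := by
      rw [hcms', Finset.card_image_of_injOn hinj, Finset.card_erase_of_mem hc₁, hcard]
      rfl
    have hmem_cms' : ∀ d, d ∈ cms' ↔ ∃ c ∈ cms.erase c₁, c.preimage (blowup.π C).continuous = d := fun d => by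
      rw [hcms', Finset.mem_image]
    set cst' : Closeds (blowup C) → State K := fun d =>
      if h : ∃ c ∈ cms.erase c₁, c.preimage (blowup.π C).continuous = d then cst h.choose else cst c₁ with hcst'
    set ctr' : Closeds (blowup C) → Finset (Fin 4) := fun d =>
      if h : ∃ c ∈ cms.erase c₁, c.preimage (blowup.π C).continuous = d then ctr h.choose else ctr c₁ with hctr'
    have hchoose : ∀ c ∈ cms.erase c₁, ∀ (h : ∃ c' ∈ cms.erase c₁,
        c'.preimage (blowup.π C).continuous = c.preimage (blowup.π C).continuous), h.choose = c :=
      fun c hc h => hinj h.choose_spec.1 hc h.choose_spec.2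
    have hcst'c : ∀ c ∈ cms.erase c₁, cst' (c.preimage (blowup.π C).continuous) = cst c ∧
        ctr' (c.preimage (blowup.π C).continuous) = ctr c := by
      intro c hc
      have h : ∃ c' ∈ cms.erase c₁, c'.preimage (blowup.π C).continuous = c.preimage (blowup.π C).continuous :=
        ⟨c, hc, rfl⟩
      constructor
      · simp only [hcst', dif_pos h]
        rw [hchoose c hc h]
      · simp only [hctr', dif_pos h]
        rw [hchoose c hc h]
    -- recurse
    refine ih (blowup C) (blowup.π C ≫ σ) M'' h₁ pts' st' (fun w hw => ?_) (fun w hw => ?_) cms' hcard' cst' ctr'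
      (fun d hd => ?_) (fun d hd d' hd' hdd => ?_) (fun w hw d hd => ?_) (fun z hz hzo => ?_)
    · -- closedness of the point members
      rcases (hmem' w).mp hw with hw | hw
      · exact ((hmem_over w).mp hw).1
      · have hz := (hmem_surv w).mp hw
        exact isClosed_singleton_of_not_mem_support hπ (hclosed _ hz) ((hCsupp _).mpr (hdisj₂ _ hz c₁ hc₁))
    · -- data of the point members
      rcases (hmem' w).mp hw with hw | hw
      · obtain ⟨j, b, hst'w, hj, hbj, hedge, heq, Y', φ', ψ', _, _, y', hφ', hψ', hMw⟩ := hover w hw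
        obtain ⟨j'', b'', -, -, heq'', hF'', hs''⟩ := id hedge
        rw [hst'w]
        refine ⟨by rw [hs'']; exact hF'', isClean_step (ctr c₁) j b (cst c₁),
          by rw [hs'']; exact ordAlong_univ_step_of_isEquimultiplePoint' (ctr c₁) j'' b'' (cst c₁) heq'',
          (hwalk₁ j b hj hbj heq).1, fun s' hs' => ?_, Y', φ', ψ', inferInstance, inferInstance, y', hφ', hψ', hMw⟩
        exact finite_closedOver_model_of_finite_pairs s'
          (ordAlong_univ_of_reflTransGen_edge (ordAlong_univ_step_of_isEquimultiplePoint' (ctr c₁) j b (cst c₁) heq) hs')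
          ((hwalk₁ j b hj hbj heq).2 s' hs')
      · have hz := (hmem_surv w).mp hw
        obtain ⟨hFz, hcleanz, hpermz, haccz, hlocfinz, Yz, φz, ψz, _, _, yz, hφz, hψz, hMz⟩ := hdata _ hz
        have hnot : blowup.π C w ∉ (C.support : Set X') := (hCsupp _).mpr (hdisj₂ _ hz c₁ hc₁)
        obtain ⟨Y', φ', ψ', _, _, y', hφ', hψ', hMw⟩ :=
          exists_zigzag_comap_controlledTransform_of_not_mem_support hπ hnot φz ψz yz hφz hψz M'.ideal
            (hypSheaf p (st (blowup.π C w)).F) hMz M'.mult (w := w) rfl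
        rw [hoff w (hdisj₂ _ hz c₁ hc₁)]
        exact ⟨hFz, hcleanz, hpermz, haccz, hlocfinz, Y', φ', ψ', inferInstance, inferInstance, y', hφ', hψ',
          by rw [hM''I]; exact hMw⟩
    · -- data of the coordinate survivors
      obtain ⟨c, hc, rfl⟩ := (hmem_cms' d).mp hd
      obtain ⟨hcst, hctr⟩ := hcst'c c hc
      rw [hcst, hctr]
      obtain ⟨hFc, hcleanc, hSc, hregc, hsncc, hfinc, hwalkc, Yc, φc, ψc, _, _, hMc, hZc, hcφc, hseec⟩ :=
        hcdata c (Finset.mem_of_mem_erase hc)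
      obtain ⟨hreg', -, hsnc'⟩ := member_survival_global hπ M' c (hdisjC c hc) hregc
        (coe_member_subset_support φc ψc M' hmult' _ hMc hSc.2 c hZc hcφc) hsnc₁ hsncc
      have hseec' : (((AffineCoordBlowup.𝓘Λ 4 K (insert 0 (Fin.succ '' ((ctr c : Finset (Fin 4)) : Set (Fin 4))))).support :
          Set (P 4 K))) ⊆ Set.range ψc := by
        rw [AffineCoordBlowup.support_𝓘Λ]; exact hseec
      obtain ⟨Y', φ', ψ', _, _, hM', hZ', hcφ', hsee'⟩ := member_survival_zigzag hπ c (hdisjC c hc) φc ψc M'.ideal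
        (hypSheaf p (cst c).F) _ hMc M'.mult hZc hcφc hseec'
      refine ⟨hFc, hcleanc, hSc, hreg', hsnc', hfinc, hwalkc, Y', φ', ψ', inferInstance, inferInstance,
        by rw [hM''I]; exact hM', hZ', hcφ', by rw [AffineCoordBlowup.support_𝓘Λ] at hsee'; exact hsee'⟩
    · -- the coordinate survivors are pairwise disjoint
      obtain ⟨c, hc, rfl⟩ := (hmem_cms' d).mp hd
      obtain ⟨c', hc', rfl⟩ := (hmem_cms' d').mp hd'
      have hcc : c ≠ c' := fun h => hdd (by rw [h])
      exact (hdisj₁ c (Finset.mem_of_mem_erase hc) c' (Finset.mem_of_mem_erase hc') hcc).preimage _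
    · -- point members avoid coordinate members
      obtain ⟨c, hc, rfl⟩ := (hmem_cms' d).mp hd
      change blowup.π C w ∉ (c : Set X')
      rcases (hmem' w).mp hw with hw | hw
      · exact fun h => Set.disjoint_left.mp (hdisj₁ c (Finset.mem_of_mem_erase hc) c₁ hc₁ (Finset.ne_of_mem_erase hc))
          h ((hmem_over w).mp hw).2.1
      · exact hdisj₂ _ ((hmem_surv w).mp hw) c (Finset.mem_of_mem_erase hc)
    · -- every closed order-`p` point of the new stage is a member
      by_cases hzx : blowup.π C z ∈ (c₁ : Set X')
      · exact Or.inl ((hmem' z).mpr (Or.inl ((hmem_over z).mpr ⟨hz, hzx, hzo⟩)))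
      · have hzo' : (p : ℕ∞) ≤ idealOrder M'.ideal (blowup.π C z) := by rw [← hsurv_ord z hzx]; exact hzo
        rcases hcover _ (isClosed_singleton_π' hπ hz) hzo' with h | ⟨c, hc, hzc⟩
        · exact Or.inl ((hmem' z).mpr (Or.inr ((hmem_surv z).mpr h)))
        · have hcc : c ≠ c₁ := fun h => hzx (by rw [← h]; exact hzc)
          exact Or.inr ⟨c.preimage (blowup.π C).continuous,
            (hmem_cms' _).mpr ⟨c, Finset.mem_erase.mpr ⟨hcc, hc⟩, rfl⟩, hzc⟩

end JointTree

end Equimultiple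

end Summit.ResolutionOfSingularities.ResolutionOfSingularities.Theorems.PIDim4

end
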